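import Summits.AtomisticToContinuum.HydrodynamicLimit.Theorems.JParityClosureLocalSecondLawRegularRangeReduction

/-!
# Coarse bounds at the doubled radius from the fixed-time field law of large numbers
(stmt-AtomisticToContinuum-13081, line `exact-entropy-ledger-three-passivities`; producer of the antecedent
`CoarseBounds2r` of `strain_of_coarseBounds` / `thermalStrain_of_coarseBounds`,
`Theorems/JParityClosureLocalSecondLawStrainOfCoarseBounds.lean`, from the SAME fixed-time inputs (H1), (H2) as the
regular range, `regularRange_of_fieldLLN` of `Theorems/JParityClosureLocalSecondLawRegularRangeReduction.lean`)

`coarseBounds_of_fieldLLN`: for limit fields `(ρ, u, θ)` with continuous space–time lifts on `[0, τ] × ℝ³`, IF (H1) the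
fixed-time field law of large numbers `TendstoHydroFieldsAt … s` holds at every `s ∈ [0, τ]` and (H2) the coarse momentum
and kinetic energy at a fixed centre are locally equicontinuous in time in probability (verbatim the hypothesis of
`regularRange_of_fieldLLN`), THEN there are levels `D = sup|ρ| + 1`, `E = sup|E_tot| + 1` such that for every `δ > 0`,
all small `r` and all large `N` the caps `ρ_{2r} ≤ D`, `e_{2r} ≤ E` hold on ALL of `[0, τ] × 𝕋³` outside an event of
`P_N`-probability `≤ δ`.  Proof: the grid upgrade of `regularRange_of_fieldLLN` at the radius `R = 2r` (`r < r₁/2`,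
`r < 1/8`), UPPER deviations of two fields only: a finite `x`-net of mesh `δx` and a finite time net by compactness of
`[0, τ]` whose windows are the minima of the clock mesh `δt` and the (H2) windows of the net centres; the coarse density
is `3/(πR⁴)`-Lipschitz in the centre and has the Lipschitz clock `3/(πR⁴)√(2K)` along good orbits (`gridUp_clock`,
`stub_meanDisplacement`, `K` from the energy tie `energyTight_of_tie` at `s = 0`); the coarse kinetic energy is
`3/(πR⁴)K`-Lipschitz in the centre and controlled in time by the (H2) events; at the net points (H1) with the tests
`b_R(·, l)` and the cone-average error (`rr_abs_integral_cone_mul_sub_le`) tie the coarse fields to the limit fields;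
five links of size `1/5` give `ρ_R ≤ ρ + 1 ≤ D`, `e_R ≤ E_tot + 1 ≤ E` off a finite union of events of vanishing
probability (plus the null bad set and the energy event).

References: C. Kipnis, C. Landim, *Scaling Limits of Interacting Particle Systems* (1999), Ch. 4; H. Spohn, *Large
Scale Dynamics of Interacting Particles* (1991), Part I §3.
-/

noncomputable section

namespace Summit.AtomisticToContinuum.HydrodynamicLimit.Theorems.LocalSecondLawLedger

open scoped BigOperators Topology Classical MeasureTheory ENNReal InnerProductSpace
open Filter Set MeasureTheory
open Literature.MathematicalPhysics.KineticTheory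
open Literature.Analysis.FluidPDE
open Literature.Analysis.FunctionSpaces (Torus.stLift Torus.stLift_apply Torus.proj Torus.proj_add
  Torus.continuous_slice_of_continuousOn_stLift Torus.continuousOn_stLift_comp₂)
open Summit.AtomisticToContinuum.HydrodynamicLimit.Theorems.LocalSecondLawNegative

/-- **Coarse bounds at the doubled radius from the fixed-time field LLN plus time-equicontinuity** (registered
sub-goal `coarseBounds_of_fieldLLN`; hypotheses (H1), (H2) verbatim those of `regularRange_of_fieldLLN`). -/
theorem coarseBounds_of_fieldLLN :
  ∀ (σ τ : ℝ) (a₀ θ₀ : T3 → ℝ) (u₀ : T3 → V3) (Φ : (N : ℕ) → Flow σ N) (ρ θ : ℝ → T3 → ℝ) (u : ℝ → T3 → V3), ContinuousOn (Literature.Analysis.FunctionSpaces.Torus.stLift ρ) (Set.Icc 0 τ ×ˢ Set.univ) → ContinuousOn (Literature.Analysis.FunctionSpaces.Torus.stLift u) (Set.Icc 0 τ ×ˢ Set.univ) → ContinuousOn (Literature.Analysis.FunctionSpaces.Torus.stLift θ) (Set.Icc 0 τ ×ˢ Set.univ) → (∀ s ∈ Set.Icc 0 τ, TendstoHydroFieldsAt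 (fun N => localGibbsLaw σ a₀ u₀ θ₀ N (Φ N)) Φ ρ u θ s) → (∃ r₁ : ℝ, 0 < r₁ ∧ ∀ r : ℝ, 0 < r → r < r₁ → ∀ x : T3, ∀ s ∈ Set.Icc 0 τ, ∀ ε : ℝ, 0 < ε → ∃ ϖ : ℝ, 0 < ϖ ∧ Tendsto (fun N => localGibbsLaw σ a₀ u₀ θ₀ N (Φ N) {z | ∃ s' ∈ Set.Icc 0 τ, |s' - s| ≤ ϖ ∧ ε < ‖momC r ((Φ N).flow s' z) x - momC r ((Φ N).flow s z) x‖ + |kinC r ((Φ N).flow s' z) x - kinC r ((Φ N).flow s z) x|}) atTop (𝓝 0)) → ∃ D : ℝ, 0 < D ∧ ∃ E : ℝ, 0 < E ∧ ∀ δ : ℝ, 0 < δ → ∃ r₀ : ℝ, 0 < r₀ ∧ ∀ r : ℝ, 0 < r → r < r₀ → ∃ N₀ : ℕ, ∀ N : ℕ, N₀ ≤ N → localGibbsLaw σ a₀ u₀ θ₀ N (Φ N) {z | ∃ s ∈ Set.Icc (0 : ℝ) τ, ∃ x : T3, D < rhoC (2 * r) ((Φ N).flow s z) x ∨ E < kinC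 (2 * r) ((Φ N).flow s z) x} ≤ ENNReal.ofReal δ := by
  intro σ τ a₀ θ₀ u₀ Φ ρ θ u hρc huc hθc hlln hosc
  set P : (N : ℕ) → Measure (Phase N) := fun N => localGibbsLaw σ a₀ u₀ θ₀ N (Φ N) with hPdef
  rcases lt_or_ge τ 0 with hτ | hτ
  · -- empty time interval: the event is empty
    refine ⟨1, one_pos, 1, one_pos, fun δ hδ => ⟨1, one_pos, fun r hr hr1 => ⟨0, fun N _ => ?_⟩⟩⟩
    have hemp : {z : Phase N | ∃ s ∈ Set.Icc (0 : ℝ) τ, ∃ x : T3,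
        1 < rhoC (2 * r) ((Φ N).flow s z) x ∨ 1 < kinC (2 * r) ((Φ N).flow s z) x} = ∅ := by
      ext z
      simp only [Set.mem_setOf_eq, Set.mem_empty_iff_false, iff_false, not_exists, not_and]
      intro s hs
      exact absurd (hs.1.trans hs.2) (not_le.2 hτ)
    rw [hemp, measure_empty]
    exact zero_le
  -- Step 0: Euler-side constants by compactness
  obtain ⟨Bρ, hBρ0, hBρle⟩ := rr_exists_bound hρc
  have hEc : ContinuousOn (Torus.stLift fun s x => totalEnergyDensity (ρ s x) (u s x) (θ s x))
      (Icc 0 τ ×ˢ univ) := by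
    have h1 : ContinuousOn (Torus.stLift fun s x => ‖u s x‖ ^ 2 / 2 + 3 / 2 * θ s x) (Icc 0 τ ×ˢ univ) :=
      Torus.continuousOn_stLift_comp₂ huc hθc (Φ := fun a b => ‖a‖ ^ 2 / 2 + 3 / 2 * b)
        (show Continuous fun p : V3 × ℝ => ‖p.1‖ ^ 2 / 2 + 3 / 2 * p.2 by fun_prop)
    exact Torus.continuousOn_stLift_comp₂ hρc h1 (Φ := fun a b => a * b) continuous_mul
  obtain ⟨BE, hBE0, hBEle⟩ := rr_exists_bound hEc
  set ε₅ : ℝ := 1 / 5 with hε₅def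
  have hε₅ : 0 < ε₅ := by norm_num
  -- the joint moduli at tolerance ε₅
  obtain ⟨ϖ₁, hϖ₁, hmod₁⟩ := rr_modulus hρc hε₅
  obtain ⟨ϖ₃, hϖ₃, hmod₃⟩ := rr_modulus hEc hε₅
  set ϖ : ℝ := min ϖ₁ ϖ₃ with hϖdef
  have hϖ : 0 < ϖ := lt_min hϖ₁ hϖ₃
  have hϖ1 : ϖ ≤ ϖ₁ := min_le_left _ _
  have hϖ3 : ϖ ≤ ϖ₃ := min_le_right _ _
  obtain ⟨r₁, hr₁, hosc⟩ := hosc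
  -- the energy tie (the `χ ≡ 1` instance of (H1) at `s = 0`)
  set K : ℝ := (∫ x, totalEnergyDensity (ρ 0 x) (u 0 x) (θ 0 x)) + 1 with hKdef
  have hK : Tendsto (fun N => P N {z | K < ((N + 1 : ℕ) : ℝ)⁻¹ * configEnergy z}) atTop (𝓝 0) :=
    energyTight_of_tie Φ (hlln 0 ⟨le_rfl, hτ⟩)
  -- the output levels and resolution
  refine ⟨Bρ + 1, by linarith, BE + 1, by linarith, fun δ hδ => ?_⟩
  refine ⟨min (ϖ / 4) (min (r₁ / 2) (1 / 8)), lt_min (by positivity) (lt_min (half_pos hr₁) (by norm_num)),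
    fun r hr hrr₀ => ?_⟩
  set R : ℝ := 2 * r with hRdef
  have hR : 0 < R := by positivity
  have hRϖ : R < ϖ := by
    have := hrr₀.trans_le (min_le_left _ _)
    rw [hRdef]; linarith
  have hRr₁ : R < r₁ := by
    have := hrr₀.trans_le ((min_le_right _ _).trans (min_le_left _ _))
    rw [hRdef]; linarith
  have hR2 : R ≤ 1 / 2 := by
    have := hrr₀.trans_le ((min_le_right _ _).trans (min_le_right _ _))
    rw [hRdef]; linarith
  -- constants at fixed `R`
  set L : ℝ := 3 / (Real.pi * R ^ 4) with hLdef
  have hL : 0 < L := by positivity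
  set Ka : ℝ := |K| + 1 with hKadef
  have hKa : 0 < Ka := by positivity
  set δx : ℝ := min (ϖ / 2) (ε₅ / (L * Ka)) with hδxdef
  have hδx : 0 < δx := lt_min (half_pos hϖ) (by positivity)
  have hδxϖ : δx < ϖ := (min_le_left _ _).trans_lt (half_lt_self hϖ)
  have hδx₂ : L * Ka * δx ≤ ε₅ := by
    calc L * Ka * δx ≤ L * Ka * (ε₅ / (L * Ka)) :=
          mul_le_mul_of_nonneg_left (min_le_right _ _) (by positivity)
      _ = ε₅ := by field_simp
  set V : ℝ := Real.sqrt (2 * K) with hVdef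
  have hV : 0 ≤ V := Real.sqrt_nonneg _
  set δt : ℝ := min (ϖ / 2) (ε₅ / (L * (V + 1))) with hδtdef
  have hδt : 0 < δt := lt_min (half_pos hϖ) (by positivity)
  have hδtϖ : δt < ϖ := (min_le_left _ _).trans_lt (half_lt_self hϖ)
  have hδt₂ : L * V * δt ≤ ε₅ := by
    calc L * V * δt ≤ L * (V + 1) * δt := by gcongr; linarith
      _ ≤ L * (V + 1) * (ε₅ / (L * (V + 1))) :=
          mul_le_mul_of_nonneg_left (min_le_right _ _) (by positivity)
      _ = ε₅ := by field_simp
  -- the `x`-net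
  obtain ⟨Sx, hSx⟩ := gridUp_euclidNet hδx
  have hSne : Sx.Nonempty := by
    obtain ⟨y, hy, -⟩ := hSx 0
    exact ⟨y, hy⟩
  -- the (H2) windows at radius `R` and tolerance ε₅
  have hwin : ∀ (l : T3) (s : ℝ), ∃ w : ℝ, 0 < w ∧ (s ∈ Icc 0 τ →
      Tendsto (fun N => P N {z | ∃ s' ∈ Icc 0 τ, |s' - s| ≤ w ∧
        ε₅ < ‖momC R ((Φ N).flow s' z) l - momC R ((Φ N).flow s z) l‖ +
          |kinC R ((Φ N).flow s' z) l - kinC R ((Φ N).flow s z) l|}) atTop (𝓝 0)) := by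
    intro l s
    by_cases hs : s ∈ Icc 0 τ
    · obtain ⟨w, hw, h⟩ := hosc R hR hRr₁ l s hs ε₅ hε₅
      exact ⟨w, hw, fun _ => h⟩
    · exact ⟨1, one_pos, fun h => absurd h hs⟩
  choose wf hwf_pos hwf using hwin
  -- the window radius about a time
  set wr : ℝ → ℝ := fun s => min δt (Sx.inf' hSne fun l => wf l s) with hwrdef
  have hwr : ∀ s, 0 < wr s := fun s =>
    lt_min hδt ((Finset.lt_inf'_iff hSne).2 fun l _ => hwf_pos l s)
  have hwr_δt : ∀ s, wr s ≤ δt := fun s => min_le_left _ _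
  have hwr_wf : ∀ s, ∀ l ∈ Sx, wr s ≤ wf l s := fun s l hl =>
    (min_le_right _ _).trans (Finset.inf'_le (fun l => wf l s) hl)
  -- the time net (compactness of `[0, τ]`)
  obtain ⟨St, hSt, hcover⟩ := isCompact_Icc.elim_nhds_subcover (fun s => Ioo (s - wr s) (s + wr s))
    (fun s _ => Ioo_mem_nhds (by linarith [hwr s]) (by linarith [hwr s]))
  have hnet : ∀ s ∈ Icc 0 τ, ∃ k ∈ St, |s - k| < wr k := by
    intro s hs
    have h := hcover hs
    simp only [mem_iUnion, exists_prop] at h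
    obtain ⟨k, hk, hsk⟩ := h
    exact ⟨k, hk, abs_sub_lt_iff.2 ⟨by linarith [hsk.2], by linarith [hsk.1]⟩⟩
  -- the grid events
  set Aρ : (N : ℕ) → ℝ → T3 → Set (Phase N) := fun N k l =>
    {z | ε₅ < |empiricalDensityField ((Φ N).flow k z) (fun y => cone R y l) - ∫ y, cone R y l * ρ k y|}
    with hAρdef
  set Ae : (N : ℕ) → ℝ → T3 → Set (Phase N) := fun N k l =>
    {z | ε₅ < |empiricalEnergyField ((Φ N).flow k z) (fun y => cone R y l) -
      ∫ y, cone R y l * totalEnergyDensity (ρ k y) (u k y) (θ k y)|} with hAedef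
  set Ao : (N : ℕ) → ℝ → T3 → Set (Phase N) := fun N k l =>
    {z | ∃ s' ∈ Icc 0 τ, |s' - k| ≤ wf l k ∧
      ε₅ < ‖momC R ((Φ N).flow s' z) l - momC R ((Φ N).flow k z) l‖ +
        |kinC R ((Φ N).flow s' z) l - kinC R ((Φ N).flow k z) l|} with hAodef
  set En : (N : ℕ) → Set (Phase N) := fun N => {z | K < ((N + 1 : ℕ) : ℝ)⁻¹ * configEnergy z}
    with hEndef
  -- their laws vanish
  have hχ : ∀ l : T3, Continuous fun y : T3 => cone R y l := fun l => densMod_continuous_cone R l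
  have hAρ : ∀ k ∈ St, ∀ l, Tendsto (fun N => P N (Aρ N k l)) atTop (𝓝 0) :=
    fun k hk l => (hlln k (hSt k hk) _ (hχ l) ε₅ hε₅).1
  have hAe : ∀ k ∈ St, ∀ l, Tendsto (fun N => P N (Ae N k l)) atTop (𝓝 0) :=
    fun k hk l => (hlln k (hSt k hk) _ (hχ l) ε₅ hε₅).2.2
  have hAo : ∀ k ∈ St, ∀ l, Tendsto (fun N => P N (Ao N k l)) atTop (𝓝 0) :=
    fun k hk l => hwf l k (hSt k hk)
  set f : ℕ → ℝ≥0∞ := fun N => P N (En N) +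
    ∑ k ∈ St, ∑ l ∈ Sx, (P N (Aρ N k l) + P N (Ae N k l) + P N (Ao N k l)) with hfdef
  have hf : Tendsto f atTop (𝓝 0) := by
    have hsum : Tendsto (fun N => ∑ k ∈ St, ∑ l ∈ Sx,
        (P N (Aρ N k l) + P N (Ae N k l) + P N (Ao N k l))) atTop (𝓝 0) := by
      have h := tendsto_finsetSum St fun k hk => tendsto_finsetSum Sx fun l (_ : l ∈ Sx) =>
        ((hAρ k hk l).add (hAe k hk l)).add (hAo k hk l)
      simpa only [Finset.sum_const_zero, add_zero] using h
    simpa only [add_zero] using hK.add hsum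
  -- KEY (deterministic): off the grid events, a good configuration of energy `≤ K` obeys the caps
  have key : ∀ (N : ℕ) (z : Phase N), z ∈ (Φ N).good → ((N + 1 : ℕ) : ℝ)⁻¹ * configEnergy z ≤ K →
      (∀ k ∈ St, ∀ l ∈ Sx, z ∉ Aρ N k l ∧ z ∉ Ae N k l ∧ z ∉ Ao N k l) →
      ∀ s ∈ Icc 0 τ, ∀ x : T3, rhoC R ((Φ N).flow s z) x ≤ Bρ + 1 ∧ kinC R ((Φ N).flow s z) x ≤ BE + 1 := by
    intro N z hg hKz hA s hs x
    obtain ⟨k, hk, hsk⟩ := hnet s hs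
    have hkI : k ∈ Icc 0 τ := hSt k hk
    have hsk_δt : |s - k| ≤ δt := hsk.le.trans (hwr_δt k)
    obtain ⟨l, hl, hxl⟩ := hSx x
    obtain ⟨hzρ, hze, hzo⟩ := hA k hk l hl
    set w : Phase N := (Φ N).flow s z with hw
    set wk : Phase N := (Φ N).flow k z with hwk
    have hsk_ϖ : |s - k| < ϖ := lt_of_le_of_lt hsk_δt hδtϖ
    have hxl_ϖ : Torus.euclidDist x l < ϖ := lt_of_le_of_lt hxl hδxϖ
    have hd0 : 0 ≤ Torus.euclidDist x l := norm_nonneg _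
    have hLδx : 0 ≤ L * δx := mul_nonneg hL.le (hd0.trans hxl)
    have hkew : ke w = ((N + 1 : ℕ) : ℝ)⁻¹ * configEnergy z := by
      rw [hw, ke_flow_eq (Φ N) hg s, rr_ke_eq]
    have hkeK : ke w ≤ K := hkew ▸ hKz
    have hke0 : 0 ≤ ke w := ke_nonneg w
    have hLδ : L * Torus.euclidDist x l ≤ L * δx := mul_le_mul_of_nonneg_left hxl hL.le
    -- link 1: centre-Lipschitz from `x` to the net centre `l`
    have h1ρ : |rhoC R w x - rhoC R w l| ≤ ε₅ := by
      have h : |rhoC R w x - rhoC R w l| ≤ L * Torus.euclidDist x l :=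
        gridUp_abs_mollDensity_sub_le_centre hR w x l
      have h' : L * δx * 1 ≤ L * δx * Ka :=
        mul_le_mul_of_nonneg_left (by linarith [abs_nonneg K]) hLδx
      have h'' : L * δx * Ka = L * Ka * δx := by ring
      linarith
    have h1e : |kinC R w x - kinC R w l| ≤ ε₅ := by
      have h : |kinC R w x - kinC R w l| ≤ L * Torus.euclidDist x l * ke w :=
        rr_abs_kinC_sub_le_centre hR w x l
      have h' : L * Torus.euclidDist x l * ke w ≤ L * δx * Ka :=
        mul_le_mul hLδ (by linarith [le_abs_self K]) hke0 hLδx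
      have h'' : L * δx * Ka = L * Ka * δx := by ring
      linarith
    -- link 2: in time from `s` to the net time `k` at the centre `l` (clock, resp. (H2) window)
    have h2ρ : |rhoC R w l - rhoC R wk l| ≤ ε₅ := by
      have hclock : |rhoC R w l - rhoC R wk l| ≤
          L * Real.sqrt (2 * (((N + 1 : ℕ) : ℝ)⁻¹ * configEnergy z)) * |s - k| :=
        gridUp_clock hR (Φ N) (stub_meanDisplacement (Φ N) hg) k s l
      exact hclock.trans ((capSub_clock_mono hL.le hKz hsk_δt).trans hδt₂)
    have h2e : |kinC R w l - kinC R wk l| ≤ ε₅ := by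
      have h2o : ‖momC R w l - momC R wk l‖ + |kinC R w l - kinC R wk l| ≤ ε₅ := by
        by_contra hcon
        exact hzo ⟨s, hs, hsk.le.trans (hwr_wf k l hl), lt_of_not_ge hcon⟩
      exact le_trans (le_add_of_nonneg_left (norm_nonneg _)) h2o
    -- link 3: the fixed-time LLN at the net point
    have h3ρ : |rhoC R wk l - ∫ y, cone R y l * ρ k y| ≤ ε₅ := not_lt.1 hzρ
    have h3e : |kinC R wk l - ∫ y, cone R y l * totalEnergyDensity (ρ k y) (u k y) (θ k y)| ≤ ε₅ :=
      not_lt.1 hze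
    -- link 4: the cone-average error of the limit fields
    have hkk₀ : |k - k| < ϖ := by
      rw [sub_self, abs_zero]
      exact hϖ
    have h4ρ : |(∫ y, cone R y l * ρ k y) - ρ k l| ≤ ε₅ :=
      rr_abs_integral_cone_mul_sub_le hR hR2 (Torus.continuous_slice_of_continuousOn_stLift hρc hkI) l
        fun y hy => by
          have h := hmod₁ k hkI k hkI (hkk₀.trans_le hϖ1) y l ((hy.trans hRϖ).trans_le hϖ1)
          rw [Real.norm_eq_abs] at h
          exact h.le
    have h4e : |(∫ y, cone R y l * totalEnergyDensity (ρ k y) (u k y) (θ k y)) -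
        totalEnergyDensity (ρ k l) (u k l) (θ k l)| ≤ ε₅ :=
      rr_abs_integral_cone_mul_sub_le hR hR2 (Torus.continuous_slice_of_continuousOn_stLift hEc hkI) l
        fun y hy => by
          have h := hmod₃ k hkI k hkI (hkk₀.trans_le hϖ3) y l ((hy.trans hRϖ).trans_le hϖ3)
          rw [Real.norm_eq_abs] at h
          exact h.le
    -- link 5: the modulus of the limit fields from `(k, l)` to `(s, x)`, and the sup bounds
    have hks : |k - s| < ϖ := by rw [abs_sub_comm]; exact hsk_ϖ
    have hlx : Torus.euclidDist l x < ϖ := by rw [Torus.euclidDist_comm]; exact hxl_ϖ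
    have h5ρ : |ρ k l - ρ s x| ≤ ε₅ := by
      have h := hmod₁ k hkI s hs (hks.trans_le hϖ1) l x (hlx.trans_le hϖ1)
      rw [Real.norm_eq_abs] at h
      exact h.le
    have h5e : |totalEnergyDensity (ρ k l) (u k l) (θ k l) - totalEnergyDensity (ρ s x) (u s x) (θ s x)| ≤ ε₅ := by
      have h := hmod₃ k hkI s hs (hks.trans_le hϖ3) l x (hlx.trans_le hϖ3)
      rw [Real.norm_eq_abs] at h
      exact h.le
    have h6ρ : ρ s x ≤ Bρ := by
      have h := hBρle s hs x
      rw [Real.norm_eq_abs] at h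
      exact (le_abs_self _).trans h
    have h6e : totalEnergyDensity (ρ s x) (u s x) (θ s x) ≤ BE := by
      have h := hBEle s hs x
      rw [Real.norm_eq_abs] at h
      exact (le_abs_self _).trans h
    have hε5 : ε₅ + ε₅ + ε₅ + ε₅ + ε₅ = 1 := by rw [hε₅def]; ring
    constructor
    · have t1 := (abs_sub_le_iff.1 h1ρ).1
      have t2 := (abs_sub_le_iff.1 h2ρ).1
      have t3 := (abs_sub_le_iff.1 h3ρ).1
      have t4 := (abs_sub_le_iff.1 h4ρ).1
      have t5 := (abs_sub_le_iff.1 h5ρ).1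
      linarith
    · have t1 := (abs_sub_le_iff.1 h1e).1
      have t2 := (abs_sub_le_iff.1 h2e).1
      have t3 := (abs_sub_le_iff.1 h3e).1
      have t4 := (abs_sub_le_iff.1 h4e).1
      have t5 := (abs_sub_le_iff.1 h5e).1
      linarith
  -- the measure bound
  have hdom : ∀ N, P N {z | ∃ s ∈ Set.Icc (0 : ℝ) τ, ∃ x : T3,
      Bρ + 1 < rhoC R ((Φ N).flow s z) x ∨ BE + 1 < kinC R ((Φ N).flow s z) x} ≤ f N := by
    intro N
    have hsub : {z | ∃ s ∈ Set.Icc (0 : ℝ) τ, ∃ x : T3,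
        Bρ + 1 < rhoC R ((Φ N).flow s z) x ∨ BE + 1 < kinC R ((Φ N).flow s z) x} ⊆
        ((⋃ k ∈ St, ⋃ l ∈ Sx, (Aρ N k l ∪ Ae N k l ∪ Ao N k l)) ∪ (Φ N).goodᶜ) ∪ En N := by
      rintro z ⟨s, hs, x, hz⟩
      by_cases hg : z ∈ (Φ N).good
      · by_cases hKz : ((N + 1 : ℕ) : ℝ)⁻¹ * configEnergy z ≤ K
        · by_contra hcon
          have hA : ∀ k ∈ St, ∀ l ∈ Sx, z ∉ Aρ N k l ∧ z ∉ Ae N k l ∧ z ∉ Ao N k l := by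
            intro k hk l hl
            have hnot : z ∉ (Aρ N k l ∪ Ae N k l ∪ Ao N k l) := fun hin =>
              hcon (Or.inl (Or.inl (Set.mem_iUnion₂.2 ⟨k, hk, Set.mem_iUnion₂.2 ⟨l, hl, hin⟩⟩)))
            simp only [Set.mem_union, not_or] at hnot
            exact ⟨hnot.1.1, hnot.1.2, hnot.2⟩
          obtain ⟨hρD, heE⟩ := key N z hg hKz hA s hs x
          rcases hz with hz | hz
          · exact absurd hz (not_lt.2 hρD)
          · exact absurd hz (not_lt.2 heE)
        · exact Or.inr (not_le.1 hKz)
      · exact Or.inl (Or.inr hg)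
    have hU3 : ∀ k l, P N (Aρ N k l ∪ Ae N k l ∪ Ao N k l) ≤
        P N (Aρ N k l) + P N (Ae N k l) + P N (Ao N k l) := fun k l =>
      (measure_union_le _ _).trans (add_le_add (measure_union_le _ _) le_rfl)
    have hU : P N (⋃ k ∈ St, ⋃ l ∈ Sx, (Aρ N k l ∪ Ae N k l ∪ Ao N k l)) ≤
        ∑ k ∈ St, ∑ l ∈ Sx, (P N (Aρ N k l) + P N (Ae N k l) + P N (Ao N k l)) :=
      (measure_biUnion_finset_le St _).trans (Finset.sum_le_sum fun k _ =>
        (measure_biUnion_finset_le Sx _).trans (Finset.sum_le_sum fun l _ => hU3 k l))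
    calc P N {z | ∃ s ∈ Set.Icc (0 : ℝ) τ, ∃ x : T3,
          Bρ + 1 < rhoC R ((Φ N).flow s z) x ∨ BE + 1 < kinC R ((Φ N).flow s z) x}
        ≤ P N (((⋃ k ∈ St, ⋃ l ∈ Sx, (Aρ N k l ∪ Ae N k l ∪ Ao N k l)) ∪ (Φ N).goodᶜ) ∪ En N) :=
          measure_mono hsub
      _ ≤ P N (⋃ k ∈ St, ⋃ l ∈ Sx, (Aρ N k l ∪ Ae N k l ∪ Ao N k l)) + P N (Φ N).goodᶜ + P N (En N) :=
          (measure_union_le _ _).trans (add_le_add (measure_union_le _ _) le_rfl)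
      _ ≤ (∑ k ∈ St, ∑ l ∈ Sx, (P N (Aρ N k l) + P N (Ae N k l) + P N (Ao N k l))) + 0 + P N (En N) :=
          add_le_add (add_le_add hU (le_of_eq (gridUp_localGibbsLaw_compl_good σ a₀ θ₀ u₀ N (Φ N)))) le_rfl
      _ = f N := by rw [add_zero, add_comm]
  -- `Tendsto ⇒ ∃ N₀`
  have hev : ∀ᶠ N in atTop, f N < ENNReal.ofReal δ :=
    (tendsto_order.1 hf).2 _ (ENNReal.ofReal_pos.2 hδ)
  obtain ⟨N₀, hN₀⟩ := eventually_atTop.1 hev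
  exact ⟨N₀, fun N hN => (hdom N).trans (hN₀ N hN).le⟩

/-- **The same in the crux's frame** (pre-shock, `τ < T`; registered sub-goal `coarseBounds_of_fieldLLN_euler`): for a
classical hard-sphere Euler solution the continuity inputs are automatic, so (H1) on `[0, τ]` and (H2) give the tail of
the antecedent `CoarseBounds2r` of `strain_of_coarseBounds` VERBATIM (its event carries the extra conjunct `Regular`,
dropped by monotonicity; the levels `D, E` do not depend on `c, η₁, δ`). -/
theorem coarseBounds_of_fieldLLN_euler :
  ∀ (σ τ T : ℝ) (a₀ θ₀ : T3 → ℝ) (u₀ : T3 → V3) (Φ : (N : ℕ) → Flow σ N) (ρ θ : ℝ → T3 → ℝ) (u : ℝ → T3 → V3), IsHardSphereEulerSolution σ T ρ u θ → τ < T → (∀ s ∈ Set.Icc 0 τ, TendstoHydroFieldsAt (fun N => localGibbsLaw σ a₀ u₀ θ₀ N (Φ N)) Φ ρ u θ s) → (∃ r₁ : ℝ, 0 < r₁ ∧ ∀ r : ℝ, 0 < r → r < r₁ → ∀ x : T3, ∀ s ∈ Set.Icc 0 τ, ∀ ε : ℝ, 0 < ε → ∃ ϖ : ℝ, 0 < ϖ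 ∧ Tendsto (fun N => localGibbsLaw σ a₀ u₀ θ₀ N (Φ N) {z | ∃ s' ∈ Set.Icc 0 τ, |s' - s| ≤ ϖ ∧ ε < ‖momC r ((Φ N).flow s' z) x - momC r ((Φ N).flow s z) x‖ + |kinC r ((Φ N).flow s' z) x - kinC r ((Φ N).flow s z) x|}) atTop (𝓝 0)) → ∀ c η₁ : ℝ, 0 < c → ∀ δ : ℝ, 0 < δ → ∃ D : ℝ, 0 < D ∧ ∃ E : ℝ, 0 < E ∧ ∃ r₀ : ℝ, 0 < r₀ ∧ ∀ r : ℝ, 0 < r → r < r₀ → ∃ N₀ : ℕ, ∀ N : ℕ, N₀ ≤ N → localGibbsLaw σ a₀ u₀ θ₀ N (Φ N) {z | Regular σ r τ c η₁ (Φ N) z ∧ ∃ s ∈ Set.Icc (0 : ℝ) τ, ∃ x : T3, D < rhoC (2 * r) ((Φ N).flow s z) x ∨ E < kinC (2 * r) ((Φ N).flow s z) x} ≤ ENNReal.ofReal δ := by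
  intro σ τ T a₀ θ₀ u₀ Φ ρ θ u hE hτT hlln hosc c η₁ _hc δ hδ
  have hsub : Set.Icc 0 τ ×ˢ (Set.univ : Set (EuclideanSpace ℝ (Fin 3))) ⊆ Set.Ico 0 T ×ˢ Set.univ :=
    prod_mono (Icc_subset_Ico_right hτT) Subset.rfl
  obtain ⟨D, hD, E, hE', H⟩ := coarseBounds_of_fieldLLN σ τ a₀ θ₀ u₀ Φ ρ θ u
    (hE.smooth_density.continuousOn_stLift.mono hsub) (hE.smooth_velocity.continuousOn_stLift.mono hsub)
    (hE.smooth_temperature.continuousOn_stLift.mono hsub) hlln hosc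
  obtain ⟨r₀, hr₀, H'⟩ := H δ hδ
  refine ⟨D, hD, E, hE', r₀, hr₀, fun r hr hrr => ?_⟩
  obtain ⟨N₀, HN⟩ := H' r hr hrr
  exact ⟨N₀, fun N hN => (measure_mono fun z hz => hz.2).trans (HN N hN)⟩

end Summit.AtomisticToContinuum.HydrodynamicLimit.Theorems.LocalSecondLawLedger

end
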